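import Literature.Geometry.Kaehler.ComplexTorusTranscendentalLatticeAllDegrees
import Literature.Geometry.Kaehler.ComplexTorusMiddleTranscendentalLatticeHodgeTypes
import HarnessLib

/-!
# The complexified transcendental lattice in every degree: `T^l ⊗ ℂ = Hdg^{k,p}(X, ℤ)^{⊥_ℂ} ⊇ ⊕_{r ≠ s} H^{r,s}(X) ∩ Hˡ`,
# `T^l ⊗ ℂ` is a sub-Hodge structure of `Hˡ(X)`, `dim_ℂ T^l ⊗ ℂ = rk T^l`, and dually `Hdg^{k,p}(X, ℤ) ⊗ ℂ = (T^l)^{⊥_ℂ} ⊆ H^{p,p}(X)`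

Layer `Literature/Geometry/Kaehler`, namespace `Literature.Geometry.Kaehler.ComplexTorus`; lane `lit-hodgefound` (Track 2
foundations library), seat p09, generation 32, row g32-#3. THEOREMS ONLY (0 definitions); no named fact, net debt 0. Sequel of
`ComplexTorusTranscendentalLatticeAllDegrees` (g31-#11: the degree-`l` transcendental lattice
`T = Hˡ(X, ℤ) ∩ ⋂_{s ∈ Hdg^{k,p}(X, ℤ)} ker ⟨s, ·⟩`, `k + l = |ι| = 2g`, written out; `rk T = C(2g, l) − rk Hdg^{k,p}(X, ℤ)`,
`ℚ·T = (B^{k,p})^⊥ ∩ Hˡ(X, ℚ)`) and the every-degree version of `ComplexTorusMiddleTranscendentalLatticeHodgeTypes` (g31-#2), which proved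
all of the following in the MIDDLE degree `k = l = g = 2p` in the `BilinForm ℤ`-language of g30's Hodge sublattice (DISCLOSED special case:
`mem_span_orthogonal_hodgeSublattice_iff`, `typeSubmodule_le_span_orthogonal_hodgeSublattice`, `typeProjAt_mem_span_orthogonal_hodgeSublattice`,
`mem_span_complex_integralHodgeClasses_iff`; not restated — here `k`, `l` are arbitrary complementary degrees and `T` is the written-out
annihilator of g31-#11). Carriers: `Hᵏ(X, ℂ) = Altᵏ_ℝ(E; ℂ) = ⊕_{a+c=k} Λ^{a,c}` (`typeProjAt`, `IsOfTypeAt`, `typeSubmodule`),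
`Hᵏ(X, ℤ) = integralForms Φ k`, `Hdg^{k,p}(X, ℤ) = integralHodgeClassesIn Φ k p = Hᵏ(X, ℤ) ∩ Λ^{p,p}`, `B^{k,p} = hodgeClassesIn Φ k p`,
`⟨γ, δ⟩ = poincarePairing Φ e h γ δ` (perfect over `ℂ`: `poincarePairing_isPerfPair`).

* §1 **type orthogonality across complementary degrees**: `⟨ζ, β⟩ = 0` for `ζ ∈ Λ^{a,c} ⊆ Hᵏ`, `β ∈ Λ^{r,s} ⊆ Hˡ` unless `a + r = c + s`
  (the top form `ζ ∧ β ∈ Λ^{a+r, c+s}` vanishes off type `(g, g)` — Voisin Lemma 7.30, the tree's `wedge_eq_zero_of_isOfTypeAt`); hence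
  **`Hdg^{k,p}(X, ℤ) ⊥ H^{r,s}(X)` and `B^{k,p}(X) ⊥ H^{r,s}(X)` for `r ≠ s`**.
* §2 **`T ⊗ ℂ = Hdg^{k,p}(X, ℤ)^{⊥_ℂ}`**: a complex class `v ∈ Hˡ(X, ℂ)` lies in the `ℂ`-span of `T` iff `⟨s, v⟩ = 0` for all
  `s ∈ Hdg^{k,p}(X, ℤ)` (`⊆` by definition of `T`; `=` by the dimension count `dim_ℂ Hdg^{⊥_ℂ} = C(2g, k) − rk Hdg = C(2g, l) − rk Hdg = rk T
  = dim_ℂ T ⊗ ℂ`, through the perfect complex Poincaré duality and g31-#11's rank formula); **`dim_ℂ T ⊗ ℂ = rk_ℤ T = C(2g, l) − rk Hdg^{k,p}(X, ℤ)`**.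
* §3 consequences: **`H^{r,s}(X) ⊆ T ⊗ ℂ` for all `r ≠ s`, `r + s = l`** (Huybrechts' defining property "`V^{2,0} ⊂ T_ℂ`" of the transcendental
  part, in every degree), and **`T ⊗ ℂ` is a sub-Hodge structure of `Hˡ(X)`** (stable under every `typeProjAt a b`).
* §4 dually **`Hdg^{k,p}(X, ℤ) ⊗ ℂ = (T)^{⊥_ℂ}`** (dimension count the other way); consequently **a complex class of degree `k` cup-orthogonal
  to the transcendental lattice is of type `(p, p)`** (`(T)^{⊥_ℂ} ⊆ Λ^{p,p}`).

## Contents (theorems only)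

* §1 `finrank_add_finrank_eq_add`, **`poincarePairing_eq_zero_of_isOfTypeAt_of_add_ne`**,
  **`poincarePairing_eq_zero_of_mem_integralHodgeClassesIn_of_isOfTypeAt`**, `poincarePairing_eq_zero_of_mem_hodgeClassesIn_of_isOfTypeAt`.
* §2 `finrank_alt_complex_eq_choose`, `span_complex_integralHodgeClassesIn_eq`, `finrank_span_complex_integralHodgeClassesIn`,
  **`finrank_span_complex_integralHodgeAnnihilator`**, `finrank_span_complex_integralHodgeAnnihilator_eq_finrank`,
  **`mem_span_complex_integralHodgeAnnihilator_iff`** (`T ⊗ ℂ = Hdg^{⊥_ℂ}`).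
* §3 **`mem_span_complex_integralHodgeAnnihilator_of_isOfTypeAt`** (`H^{r,s} ⊆ T ⊗ ℂ`), `typeSubmodule_le_span_complex_integralHodgeAnnihilator`,
  **`typeProjAt_mem_span_complex_integralHodgeAnnihilator`** (sub-Hodge structure).
* §4 **`mem_span_complex_integralHodgeClassesIn_iff`** (`Hdg ⊗ ℂ = T^{⊥_ℂ}`), `span_complex_integralHodgeClassesIn_le_typeSubmodule`,
  **`mem_typeSubmodule_of_forall_poincarePairing_integralHodgeAnnihilator_eq_zero`** (`T^{⊥_ℂ} ⊆ Λ^{p,p}`).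

## References

* [cite: Huybrechts2016K3, Ch. 3 Def. 2.5 (PDF p. 58: `T` "the minimal primitive sub-Hodge structure with `V^{2,0} = T^{2,0} ⊂ T_ℂ`"), Lemma 3.1 (PDF p. 62: `T(X) = NS(X)^⊥`), §1.1 (PDF p. 49: sub-Hodge structures)]
* [cite: VoisinHodgeI2002, §7.3.2 Lemma 7.30 (PDF p. 151); §6.1.3 Cor. 6.15 (PDF p. 122); §11.3.1 Def. 11.28 (PDF p. 231); §7.1.1]
* [cite: ShiodaMitani1974, §1 (pp. 152–153) and §4 p. 172 (`T_X` the orthogonal complement of `S_X`)]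
* [cite: Lange2023AbelianVarietiesComplex, §1.1.3 Cor. 1.1.19 (`Hᵏ(X, ℤ) ⊗ ℂ = Hᵏ(X, ℂ)`); §1.1.5 Thm. 1.1.21; §6.2.4 (p. 310); §7.2.2]
-/

noncomputable section

open Module Function
open Literature.Analysis.Complex (IsOfTypeAt typeProjAt isOfTypeAt_typeProjAt typeSubmodule typeProjAt_of_ne
  mem_typeSubmodule_iff_isOfTypeAt mem_typeSubmodule_iff isOfTypeAt_of_mem_typeSubmodule)

namespace Literature.Geometry.Kaehler.ComplexTorus

/-! ## §0 A generic dimension count -/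

section Aux

/-- Dimension of a pulled-back annihilator: `dim_K U^{⊥} + dim_K U = dim_K V` for `U ⊆ V` and the annihilator read in any `W ≃ V^*`. [folklore] -/
private theorem finrank_comap_dualAnnihilator_add₃₂ {K V W : Type*} [Field K] [AddCommGroup V] [Module K V] [AddCommGroup W]
    [Module K W] [FiniteDimensional K V] (U : Submodule K V) (L : W ≃ₗ[K] Module.Dual K V) :
    finrank K (U.dualAnnihilator.comap (L : W →ₗ[K] Module.Dual K V)) + finrank K U = finrank K V := by
  rw [Submodule.comap_equiv_eq_map_symm, LinearEquiv.finrank_map_eq, add_comm, Subspace.finrank_add_finrank_dualAnnihilator_eq]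

end Aux

section HodgeTypes

variable {ι : Type*} [Fintype ι] [DecidableEq ι] {E : Type*} [NormedAddCommGroup E] [NormedSpace ℂ E]
  (Φ : (ι → ℝ) ≃L[ℝ] E) {n k l : ℕ} (e : Fin n ≃ ι) (h : k + l = n) (p : ℕ)

/-! ## §1 Type orthogonality across complementary degrees -/

include Φ e h in
omit [DecidableEq ι] in
/-- `dim_ℂ E + dim_ℂ E = k + l` for complementary degrees `k + l = |ι| = 2 dim_ℂ E`. [cite: Lange2023AbelianVarietiesComplex, §1.1.1] -/
theorem finrank_add_finrank_eq_add : finrank ℂ E + finrank ℂ E = k + l := by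
  have h1 := finrank_complex_mul_two Φ e
  omega

/-- **Type orthogonality across complementary degrees**: `⟨ζ, β⟩_e = 0` for `ζ ∈ Hᵏ` of type `(a, c)` and `β ∈ Hˡ` of type `(r, s)` unless
`a + r = c + s` (the top form `ζ ∧ β` has type `(a + r, c + s)` and non-zero top forms are of type `(g, g)`; Voisin Lemma 7.30, the tree's
`wedge_eq_zero_of_isOfTypeAt`). The middle-degree case is g31-#2's `poincarePairing_eq_zero_of_isOfTypeAt_of_ne`.
[cite: VoisinHodgeI2002, §7.3.2 Lemma 7.30 (PDF p. 151) and §6.1.3 Cor. 6.15] -/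
theorem poincarePairing_eq_zero_of_isOfTypeAt_of_add_ne [FiniteDimensional ℂ E] {a c r s : ℕ} {ζ : E [⋀^Fin k]→L[ℝ] ℂ} {β : E [⋀^Fin l]→L[ℝ] ℂ}
    (hζ : IsOfTypeAt a c ζ) (hβ : IsOfTypeAt r s β) (hne : a + r ≠ c + s) : poincarePairing Φ e h ζ β = 0 := by
  rw [poincarePairing_apply, wedge_eq_zero_of_isOfTypeAt hζ hβ (finrank_add_finrank_eq_add Φ e h) hne,
    ContinuousAlternatingMap.coe_zero, Pi.zero_apply]

/-- **`Hdg^{k,p}(X, ℤ) ⊥ H^{r,s}(X)` for `r ≠ s`**: an integral Hodge class of bidegree `(k, p)` (type `(p,p)`, or zero if `k ≠ 2p`) pairs to zero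
with every class of complementary degree and type `(r, s)`, `r ≠ s` — in particular with `H^{l,0}(X) ⊕ H^{0,l}(X)`.
[cite: VoisinHodgeI2002, §7.3.2 Lemma 7.30 and §11.3.1 Def. 11.28] [cite: Huybrechts2016K3, Ch. 3 Def. 2.5 and Lemma 3.1] -/
theorem poincarePairing_eq_zero_of_mem_integralHodgeClassesIn_of_isOfTypeAt [FiniteDimensional ℂ E] {r s : ℕ} {η : E [⋀^Fin k]→L[ℝ] ℂ}
    {β : E [⋀^Fin l]→L[ℝ] ℂ} (hη : η ∈ integralHodgeClassesIn Φ k p) (hβ : IsOfTypeAt r s β) (hrs : r ≠ s) :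
    poincarePairing Φ e h η β = 0 := by
  by_cases hk : p + p = k
  · have hηT : IsOfTypeAt p p η := (mem_typeSubmodule_iff_isOfTypeAt hk).1 hη.2
    exact poincarePairing_eq_zero_of_isOfTypeAt_of_add_ne Φ e h hηT hβ fun h' ↦ hrs (by omega)
  · rw [integralHodgeClassesIn_eq_bot_of_ne Φ hk, AddSubgroup.mem_bot] at hη
    rw [hη, map_zero, LinearMap.zero_apply]

/-- **`B^{k,p}(X) ⊥ H^{r,s}(X)` for `r ≠ s`**: a rational Hodge class pairs to zero with every class of complementary degree and type `(r, s)`,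
`r ≠ s`. [cite: VoisinHodgeI2002, §7.3.2 Lemma 7.30 (PDF p. 151)] [cite: Lange2023AbelianVarietiesComplex, §7.2.2] -/
theorem poincarePairing_eq_zero_of_mem_hodgeClassesIn_of_isOfTypeAt [FiniteDimensional ℂ E] {r s : ℕ} {η : E [⋀^Fin k]→L[ℝ] ℂ}
    {β : E [⋀^Fin l]→L[ℝ] ℂ} (hη : η ∈ hodgeClassesIn Φ k p) (hβ : IsOfTypeAt r s β) (hrs : r ≠ s) :
    poincarePairing Φ e h η β = 0 := by
  by_cases hk : p + p = k
  · have hηT : IsOfTypeAt p p η := (mem_typeSubmodule_iff_isOfTypeAt hk).1 hη.2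
    exact poincarePairing_eq_zero_of_isOfTypeAt_of_add_ne Φ e h hηT hβ fun h' ↦ hrs (by omega)
  · rw [hodgeClassesIn_eq_bot_of_ne Φ hk, Submodule.mem_bot] at hη
    rw [hη, map_zero, LinearMap.zero_apply]

/-! ## §2 `T ⊗ ℂ = Hdg^{k,p}(X, ℤ)^{⊥_ℂ}` and its dimension -/

include Φ in
omit [DecidableEq ι] in
/-- `dim_ℂ Hᵏ(X, ℂ) = C(|ι|, k)` (the basis of increasing lattice monomials). [cite: Lange2023AbelianVarietiesComplex, §1.1.4 Prop. 1.1.20 and §1.1.3 Exercise 1.1.6 (8)] -/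
theorem finrank_alt_complex_eq_choose (k : ℕ) : finrank ℂ (E [⋀^Fin k]→L[ℝ] ℂ) = (Fintype.card ι).choose k := by
  classical
  letI : LinearOrder ι := LinearOrder.lift' (Fintype.equivFin ι) (Fintype.equivFin ι).injective
  rw [finrank_alt_eq_card_strictMono Φ k, Literature.AlgebraicGeometry.HodgeTheory.card_strictMono_eq_choose]

omit [DecidableEq ι] in
/-- **`Hdg^{k,p}(X, ℤ) ⊗ ℂ = B^{k,p}(X) ⊗ ℂ`** inside `Hᵏ(X, ℂ)` (`B^{k,p}` is the `ℚ`-span of its integral points).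
[cite: Lange2023AbelianVarietiesComplex, §7.2.2 ("Tensoring with `ℂ` …")] -/
theorem span_complex_integralHodgeClassesIn_eq :
    Submodule.span ℂ (integralHodgeClassesIn Φ k p : Set (E [⋀^Fin k]→L[ℝ] ℂ)) =
      Submodule.span ℂ (hodgeClassesIn Φ k p : Set (E [⋀^Fin k]→L[ℝ] ℂ)) := by
  classical
  letI : LinearOrder ι := LinearOrder.lift' (Fintype.equivFin ι) (Fintype.equivFin ι).injective
  rw [hodgeClassesIn_eq_span_integralHodgeClassesIn Φ k p, Submodule.span_span_of_tower]

omit [DecidableEq ι] in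
/-- **`dim_ℂ Hdg^{k,p}(X, ℤ) ⊗ ℂ = rk_ℤ Hdg^{k,p}(X, ℤ)`** (`= dim_ℚ B^{k,p}(X)`, g30-#9). [cite: Lange2023AbelianVarietiesComplex, §1.1.3 Cor. 1.1.19 and §7.2.2] -/
theorem finrank_span_complex_integralHodgeClassesIn :
    finrank ℂ (Submodule.span ℂ (integralHodgeClassesIn Φ k p : Set (E [⋀^Fin k]→L[ℝ] ℂ))) =
      finrank ℤ (integralHodgeClassesIn Φ k p) := by
  rw [span_complex_integralHodgeClassesIn_eq Φ, finrank_span_complex_eq Φ (W := hodgeClassesIn Φ k p) (fun _ hγ ↦ hγ.1),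
    finrank_integralHodgeClassesIn_eq_finrank_hodgeClassesIn]

/-- **`dim_ℂ T ⊗ ℂ = C(|ι|, l) − rk_ℤ Hdg^{k,p}(X, ℤ)`** for the degree-`l` transcendental lattice `T` (`ℂ·T = ℂ·(ℚ·T)`, `ℚ·T` the rational
annihilator of g31-#11, of `ℚ`-dimension `C(|ι|, l) − dim_ℚ B^{k,p}`). [cite: Huybrechts2016K3, Ch. 3 §2.3 (PDF p. 59)] [cite: Lange2023AbelianVarietiesComplex, §1.1.3 Cor. 1.1.19, §6.2.4 (p. 310) and §7.2.2] -/
theorem finrank_span_complex_integralHodgeAnnihilator :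
    finrank ℂ (Submodule.span ℂ ((integralForms Φ l ⊓ ⨅ s : integralHodgeClassesIn Φ k p,
        (LinearMap.ker (poincarePairing Φ e h (s : E [⋀^Fin k]→L[ℝ] ℂ))).toAddSubgroup :
          AddSubgroup (E [⋀^Fin l]→L[ℝ] ℂ)) : Set (E [⋀^Fin l]→L[ℝ] ℂ))) =
      (Fintype.card ι).choose l - finrank ℤ (integralHodgeClassesIn Φ k p) := by
  have h1 : Submodule.span ℂ ((integralForms Φ l ⊓ ⨅ s : integralHodgeClassesIn Φ k p,
        (LinearMap.ker (poincarePairing Φ e h (s : E [⋀^Fin k]→L[ℝ] ℂ))).toAddSubgroup :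
          AddSubgroup (E [⋀^Fin l]→L[ℝ] ℂ)) : Set (E [⋀^Fin l]→L[ℝ] ℂ)) =
      Submodule.span ℂ ((rationalForms Φ l ⊓ ⨅ s : integralHodgeClassesIn Φ k p,
        (LinearMap.ker (poincarePairing Φ e h (s : E [⋀^Fin k]→L[ℝ] ℂ))).restrictScalars ℚ :
          Submodule ℚ (E [⋀^Fin l]→L[ℝ] ℂ)) : Set (E [⋀^Fin l]→L[ℝ] ℂ)) := by
    rw [← span_rat_integralHodgeAnnihilator_eq Φ e h p, Submodule.span_span_of_tower]
  have h2 := finrank_rationalAnnihilator_add_finrank_hodgeClassesIn Φ e h p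
  rw [h1, finrank_span_complex_eq Φ inf_le_left, finrank_integralHodgeClassesIn_eq_finrank_hodgeClassesIn]
  omega

/-- **`dim_ℂ T ⊗ ℂ = rk_ℤ T`**: the integral classes of the transcendental lattice stay independent over `ℂ` (`Hˡ(X, ℤ) ⊗ ℂ = Hˡ(X, ℂ)`).
[cite: Lange2023AbelianVarietiesComplex, §1.1.3 Cor. 1.1.19] [cite: Huybrechts2016K3, Ch. 3 §2.3 (PDF p. 59)] -/
theorem finrank_span_complex_integralHodgeAnnihilator_eq_finrank :
    finrank ℂ (Submodule.span ℂ ((integralForms Φ l ⊓ ⨅ s : integralHodgeClassesIn Φ k p,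
        (LinearMap.ker (poincarePairing Φ e h (s : E [⋀^Fin k]→L[ℝ] ℂ))).toAddSubgroup :
          AddSubgroup (E [⋀^Fin l]→L[ℝ] ℂ)) : Set (E [⋀^Fin l]→L[ℝ] ℂ))) =
      finrank ℤ ↥(integralForms Φ l ⊓ ⨅ s : integralHodgeClassesIn Φ k p,
        (LinearMap.ker (poincarePairing Φ e h (s : E [⋀^Fin k]→L[ℝ] ℂ))).toAddSubgroup) := by
  rw [finrank_span_complex_integralHodgeAnnihilator, finrank_integralHodgeAnnihilator_eq Φ e h p]

/-- Membership in the pull-back of the annihilator of `span S ⊆ Hᵏ(X, ℂ)` along `v ↦ ⟨·, v⟩ : Hˡ(X, ℂ) ⥲ Hᵏ(X, ℂ)^*`.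
[cite: Lange2023AbelianVarietiesComplex, §6.2.4 (p. 310)] -/
private theorem mem_comap_flip_dualAnnihilator_iff₃₂ (S : Set (E [⋀^Fin k]→L[ℝ] ℂ)) (v : E [⋀^Fin l]→L[ℝ] ℂ) :
    v ∈ (Submodule.span ℂ S).dualAnnihilator.comap
      (((poincarePairing Φ e h).flip.toPerfPair : (E [⋀^Fin l]→L[ℝ] ℂ) ≃ₗ[ℂ] Module.Dual ℂ (E [⋀^Fin k]→L[ℝ] ℂ)) :
        (E [⋀^Fin l]→L[ℝ] ℂ) →ₗ[ℂ] Module.Dual ℂ (E [⋀^Fin k]→L[ℝ] ℂ)) ↔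
      ∀ s ∈ S, poincarePairing Φ e h s v = 0 := by
  rw [Submodule.mem_comap, Submodule.mem_dualAnnihilator]
  simp only [LinearEquiv.coe_coe, LinearMap.toPerfPair_apply, LinearMap.flip_apply]
  constructor
  · exact fun H s hs ↦ H s (Submodule.subset_span hs)
  · intro H w hw
    have hle : Submodule.span ℂ S ≤ LinearMap.ker ((poincarePairing Φ e h).flip v) :=
      Submodule.span_le.2 fun s hs ↦ by simpa [LinearMap.mem_ker, LinearMap.flip_apply] using H s hs
    simpa [LinearMap.mem_ker, LinearMap.flip_apply] using hle hw

/-- Membership in the pull-back of the annihilator of `span S ⊆ Hˡ(X, ℂ)` along `v ↦ ⟨v, ·⟩ : Hᵏ(X, ℂ) ⥲ Hˡ(X, ℂ)^*`.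
[cite: Lange2023AbelianVarietiesComplex, §6.2.4 (p. 310)] -/
private theorem mem_comap_dualAnnihilator_iff₃₂ (S : Set (E [⋀^Fin l]→L[ℝ] ℂ)) (v : E [⋀^Fin k]→L[ℝ] ℂ) :
    v ∈ (Submodule.span ℂ S).dualAnnihilator.comap
      (((poincarePairing Φ e h).toPerfPair : (E [⋀^Fin k]→L[ℝ] ℂ) ≃ₗ[ℂ] Module.Dual ℂ (E [⋀^Fin l]→L[ℝ] ℂ)) :
        (E [⋀^Fin k]→L[ℝ] ℂ) →ₗ[ℂ] Module.Dual ℂ (E [⋀^Fin l]→L[ℝ] ℂ)) ↔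
      ∀ t ∈ S, poincarePairing Φ e h v t = 0 := by
  rw [Submodule.mem_comap, Submodule.mem_dualAnnihilator]
  simp only [LinearEquiv.coe_coe, LinearMap.toPerfPair_apply]
  constructor
  · exact fun H t ht ↦ H t (Submodule.subset_span ht)
  · intro H w hw
    have hle : Submodule.span ℂ S ≤ LinearMap.ker (poincarePairing Φ e h v) :=
      Submodule.span_le.2 fun t ht ↦ by simpa [LinearMap.mem_ker] using H t ht
    simpa [LinearMap.mem_ker] using hle hw

include e h in
omit [DecidableEq ι] in
/-- `C(|ι|, k) = C(|ι|, l)` for complementary degrees. [folklore] -/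
private theorem choose_eq_choose_of_add : (Fintype.card ι).choose k = (Fintype.card ι).choose l := by
  have hcard : Fintype.card ι = k + l := by rw [← Fintype.card_congr e, Fintype.card_fin, h]
  rw [hcard, Nat.choose_symm_add]

/-- **`T ⊗ ℂ = Hdg^{k,p}(X, ℤ)^{⊥_ℂ}`** for the degree-`l` transcendental lattice `T = Hdg^{k,p}(X, ℤ)^⊥ ∩ Hˡ(X, ℤ)` (`k + l = 2g`): a complex
class `v ∈ Hˡ(X, ℂ)` lies in the `ℂ`-span of `T` iff `⟨s, v⟩ = 0` for every integral Hodge class `s ∈ Hdg^{k,p}(X, ℤ)` (`⊆`: the definition of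
`T`; `=`: `dim_ℂ Hdg^{⊥_ℂ} = C(2g, k) − rk Hdg = C(2g, l) − rk Hdg = dim_ℂ T ⊗ ℂ` through the perfect complex Poincaré duality
`poincarePairing_isPerfPair`). The middle degree is g31-#2's `mem_span_orthogonal_hodgeSublattice_iff`.
[cite: ShiodaMitani1974, §1 (pp. 152–153)] [cite: Huybrechts2016K3, Ch. 3 Def. 2.5 and Lemma 3.1] [cite: Lange2023AbelianVarietiesComplex, §6.2.4 (p. 310) and §7.2.2] -/
theorem mem_span_complex_integralHodgeAnnihilator_iff {v : E [⋀^Fin l]→L[ℝ] ℂ} :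
    v ∈ Submodule.span ℂ ((integralForms Φ l ⊓ ⨅ s : integralHodgeClassesIn Φ k p,
        (LinearMap.ker (poincarePairing Φ e h (s : E [⋀^Fin k]→L[ℝ] ℂ))).toAddSubgroup :
          AddSubgroup (E [⋀^Fin l]→L[ℝ] ℂ)) : Set (E [⋀^Fin l]→L[ℝ] ℂ)) ↔
      ∀ s ∈ integralHodgeClassesIn Φ k p, poincarePairing Φ e h s v = 0 := by
  haveI := finiteDimensional_alt_complex Φ k
  haveI := finiteDimensional_alt_complex Φ l
  -- the complex orthogonal of `Hdg`, as a submodule of `Hˡ(X, ℂ)`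
  set K := (Submodule.span ℂ (integralHodgeClassesIn Φ k p : Set (E [⋀^Fin k]→L[ℝ] ℂ))).dualAnnihilator.comap
      (((poincarePairing Φ e h).flip.toPerfPair : (E [⋀^Fin l]→L[ℝ] ℂ) ≃ₗ[ℂ] Module.Dual ℂ (E [⋀^Fin k]→L[ℝ] ℂ)) :
        (E [⋀^Fin l]→L[ℝ] ℂ) →ₗ[ℂ] Module.Dual ℂ (E [⋀^Fin k]→L[ℝ] ℂ)) with hK
  set TC := Submodule.span ℂ ((integralForms Φ l ⊓ ⨅ s : integralHodgeClassesIn Φ k p,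
        (LinearMap.ker (poincarePairing Φ e h (s : E [⋀^Fin k]→L[ℝ] ℂ))).toAddSubgroup :
          AddSubgroup (E [⋀^Fin l]→L[ℝ] ℂ)) : Set (E [⋀^Fin l]→L[ℝ] ℂ)) with hTC
  -- `T ⊗ ℂ ⊆ Hdg^{⊥_ℂ}`
  have hle : TC ≤ K := by
    refine Submodule.span_le.2 fun t ht ↦ ?_
    rw [SetLike.mem_coe, hK, mem_comap_flip_dualAnnihilator_iff₃₂]
    exact ((mem_integralHodgeAnnihilator_iff Φ e h p).1 ht).2
  -- equal dimensions
  have hdim : finrank ℂ TC = finrank ℂ K := by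
    have h1 := finrank_comap_dualAnnihilator_add₃₂ (Submodule.span ℂ (integralHodgeClassesIn Φ k p : Set (E [⋀^Fin k]→L[ℝ] ℂ)))
      ((poincarePairing Φ e h).flip.toPerfPair)
    rw [← hK, finrank_span_complex_integralHodgeClassesIn Φ, finrank_alt_complex_eq_choose Φ k, choose_eq_choose_of_add e h] at h1
    rw [hTC, finrank_span_complex_integralHodgeAnnihilator Φ e h p]
    have h2 := finrank_integralHodgeAnnihilator_add_finrank_integralHodgeClassesIn Φ e h p
    omega
  have hKT : TC = K := Submodule.eq_of_le_of_finrank_eq hle hdim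
  rw [hKT, hK, mem_comap_flip_dualAnnihilator_iff₃₂]
  rfl

/-! ## §3 `H^{r,s} ⊆ T ⊗ ℂ` for `r ≠ s`; `T ⊗ ℂ` is a sub-Hodge structure -/

/-- **`H^{r,s}(X) ⊆ T ⊗ ℂ` for `r ≠ s` (`r + s = l`)**: every class of type `(r, s)`, `r ≠ s`, of degree `l` lies in the complexified
transcendental lattice — Huybrechts' "`V^{2,0} = T^{2,0} ⊂ T_ℂ`" in every degree: `H^{l,0}(X) ⊕ ⋯ ⊕ \widehat{H^{g−p,g−p}} ⊕ ⋯ ⊕ H^{0,l}(X) ⊆ T ⊗ ℂ`.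
[cite: Huybrechts2016K3, Ch. 3 Def. 2.5 (PDF p. 58)] [cite: VoisinHodgeI2002, §7.3.2 Lemma 7.30 (PDF p. 151)] -/
theorem mem_span_complex_integralHodgeAnnihilator_of_isOfTypeAt [FiniteDimensional ℂ E] {r s : ℕ} {β : E [⋀^Fin l]→L[ℝ] ℂ} (hβ : IsOfTypeAt r s β)
    (hrs : r ≠ s) :
    β ∈ Submodule.span ℂ ((integralForms Φ l ⊓ ⨅ s : integralHodgeClassesIn Φ k p,
        (LinearMap.ker (poincarePairing Φ e h (s : E [⋀^Fin k]→L[ℝ] ℂ))).toAddSubgroup :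
          AddSubgroup (E [⋀^Fin l]→L[ℝ] ℂ)) : Set (E [⋀^Fin l]→L[ℝ] ℂ)) :=
  (mem_span_complex_integralHodgeAnnihilator_iff Φ e h p).2 fun _ hs ↦
    poincarePairing_eq_zero_of_mem_integralHodgeClassesIn_of_isOfTypeAt Φ e h p hs hβ hrs

/-- **`Λ^{r,s} ∩ Hˡ ⊆ T ⊗ ℂ` for `r ≠ s`** (as submodules). [cite: Huybrechts2016K3, Ch. 3 Def. 2.5 (PDF p. 58)] [cite: VoisinHodgeI2002, §7.3.2 Lemma 7.30] -/
theorem typeSubmodule_le_span_complex_integralHodgeAnnihilator [FiniteDimensional ℂ E] {r s : ℕ} (hrs : r ≠ s) :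
    typeSubmodule E l r s ≤ Submodule.span ℂ ((integralForms Φ l ⊓ ⨅ s : integralHodgeClassesIn Φ k p,
        (LinearMap.ker (poincarePairing Φ e h (s : E [⋀^Fin k]→L[ℝ] ℂ))).toAddSubgroup :
          AddSubgroup (E [⋀^Fin l]→L[ℝ] ℂ)) : Set (E [⋀^Fin l]→L[ℝ] ℂ)) := by
  intro β hβ
  by_cases hsum : r + s = l
  · exact mem_span_complex_integralHodgeAnnihilator_of_isOfTypeAt Φ e h p (isOfTypeAt_of_mem_typeSubmodule hsum hβ) hrs
  · have h0 : β = 0 := by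
      have h1 := mem_typeSubmodule_iff.1 hβ
      rw [typeProjAt_of_ne hsum] at h1
      exact h1.symm
    rw [h0]
    exact Submodule.zero_mem _

/-- **`T ⊗ ℂ` is a sub-Hodge structure of `Hˡ(X)`**: the `ℂ`-span of the transcendental lattice is stable under every projection `v ↦ v^{a,b}`
of the Hodge decomposition `Hˡ(X, ℂ) = ⊕_{a+b=l} H^{a,b}` ("`W_ℂ = ⊕ (W_ℂ ∩ V^{p,q})`"): against an integral Hodge class `s` of type `(p,p)`
only the component `v^{g−p,g−p}` pairs (`⟨s, v⟩ = ⟨s, v^{g−p,g−p}⟩`, the tree's `wedge_eq_wedge_typeProjAt`), so it is orthogonal to `Hdg` with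
`v`; every other component is orthogonal to `Hdg` by §1. [cite: Huybrechts2016K3, Ch. 3 §1.1 (PDF p. 49) and Def. 2.5 (PDF p. 58)] [cite: VoisinHodgeI2002, §7.3.2 Lemma 7.30 and §7.1.1] -/
theorem typeProjAt_mem_span_complex_integralHodgeAnnihilator [FiniteDimensional ℂ E] {v : E [⋀^Fin l]→L[ℝ] ℂ}
    (hv : v ∈ Submodule.span ℂ ((integralForms Φ l ⊓ ⨅ s : integralHodgeClassesIn Φ k p,
        (LinearMap.ker (poincarePairing Φ e h (s : E [⋀^Fin k]→L[ℝ] ℂ))).toAddSubgroup :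
          AddSubgroup (E [⋀^Fin l]→L[ℝ] ℂ)) : Set (E [⋀^Fin l]→L[ℝ] ℂ)))
    (a b : ℕ) :
    typeProjAt a b v ∈ Submodule.span ℂ ((integralForms Φ l ⊓ ⨅ s : integralHodgeClassesIn Φ k p,
        (LinearMap.ker (poincarePairing Φ e h (s : E [⋀^Fin k]→L[ℝ] ℂ))).toAddSubgroup :
          AddSubgroup (E [⋀^Fin l]→L[ℝ] ℂ)) : Set (E [⋀^Fin l]→L[ℝ] ℂ)) := by
  by_cases hab : a + b = l
  · by_cases hdiag : a = b
    · -- the diagonal component: `⟨s, v^{a,a}⟩ = ⟨s, v⟩ = 0` for `s` of type `(p,p)` (when `p + a = g`), else `s = 0`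
      subst hdiag
      rw [mem_span_complex_integralHodgeAnnihilator_iff] at hv ⊢
      intro s hs
      by_cases hk : p + p = k
      · have hss : IsOfTypeAt p p s := (mem_typeSubmodule_iff_isOfTypeAt hk).1 hs.2
        have hfin := finrank_add_finrank_eq_add Φ e h
        rw [poincarePairing_apply, ← wedge_eq_wedge_typeProjAt (r := a) (s := a) hss hfin (by omega) (by omega) v,
          ← poincarePairing_apply]
        exact hv s hs
      · rw [integralHodgeClassesIn_eq_bot_of_ne Φ hk, AddSubgroup.mem_bot] at hs
        rw [hs, map_zero, LinearMap.zero_apply]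
    · exact mem_span_complex_integralHodgeAnnihilator_of_isOfTypeAt Φ e h p (isOfTypeAt_typeProjAt hab v) hdiag
  · rw [typeProjAt_of_ne hab]
    exact Submodule.zero_mem _

/-! ## §4 `Hdg^{k,p}(X, ℤ) ⊗ ℂ = T^{⊥_ℂ} ⊆ Λ^{p,p}` -/

/-- **`Hdg^{k,p}(X, ℤ) ⊗ ℂ = T^{⊥_ℂ}`**: a complex class `v ∈ Hᵏ(X, ℂ)` lies in the `ℂ`-span of the integral Hodge classes iff it is
cup-orthogonal to the transcendental lattice `T ⊆ Hˡ(X, ℤ)` (`⊆`: `T = Hdg^⊥`; `=`: `dim_ℂ T^{⊥_ℂ} = C(2g, l) − dim_ℂ T ⊗ ℂ = rk Hdg =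
dim_ℂ Hdg ⊗ ℂ`). The middle degree is g31-#2's `mem_span_complex_integralHodgeClasses_iff`.
[cite: ShiodaMitani1974, §1 (pp. 152–153) and §4 p. 172] [cite: Huybrechts2016K3, Ch. 3 Lemma 3.1 (PDF p. 62)] [cite: Lange2023AbelianVarietiesComplex, §6.2.4 (p. 310) and §7.2.2] -/
theorem mem_span_complex_integralHodgeClassesIn_iff {v : E [⋀^Fin k]→L[ℝ] ℂ} :
    v ∈ Submodule.span ℂ (integralHodgeClassesIn Φ k p : Set (E [⋀^Fin k]→L[ℝ] ℂ)) ↔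
      ∀ t ∈ integralForms Φ l ⊓ ⨅ s : integralHodgeClassesIn Φ k p,
        (LinearMap.ker (poincarePairing Φ e h (s : E [⋀^Fin k]→L[ℝ] ℂ))).toAddSubgroup, poincarePairing Φ e h v t = 0 := by
  haveI := finiteDimensional_alt_complex Φ k
  haveI := finiteDimensional_alt_complex Φ l
  set TS : Set (E [⋀^Fin l]→L[ℝ] ℂ) := ((integralForms Φ l ⊓ ⨅ s : integralHodgeClassesIn Φ k p,
        (LinearMap.ker (poincarePairing Φ e h (s : E [⋀^Fin k]→L[ℝ] ℂ))).toAddSubgroup :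
          AddSubgroup (E [⋀^Fin l]→L[ℝ] ℂ)) : Set (E [⋀^Fin l]→L[ℝ] ℂ)) with hTS
  -- the complex orthogonal of `T`, as a submodule of `Hᵏ(X, ℂ)`
  set K := (Submodule.span ℂ TS).dualAnnihilator.comap
      (((poincarePairing Φ e h).toPerfPair : (E [⋀^Fin k]→L[ℝ] ℂ) ≃ₗ[ℂ] Module.Dual ℂ (E [⋀^Fin l]→L[ℝ] ℂ)) :
        (E [⋀^Fin k]→L[ℝ] ℂ) →ₗ[ℂ] Module.Dual ℂ (E [⋀^Fin l]→L[ℝ] ℂ)) with hK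
  have hmemK : ∀ w, w ∈ K ↔ ∀ t ∈ integralForms Φ l ⊓ ⨅ s : integralHodgeClassesIn Φ k p,
      (LinearMap.ker (poincarePairing Φ e h (s : E [⋀^Fin k]→L[ℝ] ℂ))).toAddSubgroup, poincarePairing Φ e h w t = 0 := fun w ↦ by
    rw [hK, mem_comap_dualAnnihilator_iff₃₂, hTS]
    rfl
  set HC := Submodule.span ℂ (integralHodgeClassesIn Φ k p : Set (E [⋀^Fin k]→L[ℝ] ℂ)) with hHC
  -- `Hdg ⊗ ℂ ⊆ T^{⊥_ℂ}`
  have hle : HC ≤ K := by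
    refine Submodule.span_le.2 fun s hs ↦ ?_
    rw [SetLike.mem_coe, hmemK]
    intro t ht
    exact ((mem_integralHodgeAnnihilator_iff Φ e h p).1 ht).2 s hs
  have hdim : finrank ℂ HC = finrank ℂ K := by
    have h1 := finrank_comap_dualAnnihilator_add₃₂ (Submodule.span ℂ TS) (poincarePairing Φ e h).toPerfPair
    rw [← hK, hTS, finrank_span_complex_integralHodgeAnnihilator Φ e h p, finrank_alt_complex_eq_choose Φ l] at h1
    rw [hHC, finrank_span_complex_integralHodgeClassesIn Φ]
    have h2 := finrank_integralHodgeAnnihilator_add_finrank_integralHodgeClassesIn Φ e h p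
    have h3 := finrank_integralHodgeAnnihilator_eq Φ e h p
    omega
  have hKH : HC = K := Submodule.eq_of_le_of_finrank_eq hle hdim
  rw [hKH]
  exact hmemK v

omit [Fintype ι] [DecidableEq ι] in
/-- `Hdg^{k,p}(X, ℤ) ⊗ ℂ ⊆ Λ^{p,p}` (`Λ^{p,p} ∩ Hᵏ` is a complex subspace containing the integral Hodge classes).
[cite: VoisinHodgeI2002, §11.3.1 Def. 11.28] [cite: Lange2023AbelianVarietiesComplex, §7.2.2] -/
theorem span_complex_integralHodgeClassesIn_le_typeSubmodule :
    Submodule.span ℂ (integralHodgeClassesIn Φ k p : Set (E [⋀^Fin k]→L[ℝ] ℂ)) ≤ typeSubmodule E k p p :=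
  Submodule.span_le.2 fun _ hs ↦ hs.2

/-- **`T^{⊥_ℂ} ⊆ Λ^{p,p}`: a complex class of degree `k` cup-orthogonal to the transcendental lattice `T ⊆ Hˡ(X, ℤ)` is of type `(p, p)`** (it lies
in `Hdg^{k,p}(X, ℤ) ⊗ ℂ ⊆ Λ^{p,p}`) — the complex form of "`NS = T^⊥`": the transcendental lattice alone detects the Hodge type `(p,p)` in the
complementary degree. [cite: Huybrechts2016K3, Ch. 3 Lemma 3.1 (PDF p. 62)] [cite: ShiodaMitani1974, §4 p. 172] -/
theorem mem_typeSubmodule_of_forall_poincarePairing_integralHodgeAnnihilator_eq_zero {v : E [⋀^Fin k]→L[ℝ] ℂ}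
    (hv : ∀ t ∈ integralForms Φ l ⊓ ⨅ s : integralHodgeClassesIn Φ k p,
        (LinearMap.ker (poincarePairing Φ e h (s : E [⋀^Fin k]→L[ℝ] ℂ))).toAddSubgroup, poincarePairing Φ e h v t = 0) :
    v ∈ typeSubmodule E k p p :=
  span_complex_integralHodgeClassesIn_le_typeSubmodule Φ p ((mem_span_complex_integralHodgeClassesIn_iff Φ e h p).2 hv)

end HodgeTypes

end Literature.Geometry.Kaehler.ComplexTorus
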